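import Literature.Analysis.FluidPDE.Ferrari1993LogEstimateReduction
import Literature.Analysis.FunctionSpaces.SobolevDomainNormProofs
import HarnessLib

/-!
# The `δ`-family form of the stationary logarithmic div–curl estimate in the periodic cylinder
is equivalent to the estimate itself (review record of the merged fact
`ShirotaYanagisawa1993_periodicCylinderDeltaLogDivCurlEstimate`)

Topic `Literature/Analysis/FluidPDE`. **Everything here is proved; the file declares no
definition and no named fact.**

The stationary logarithmic estimate `ShirotaYanagisawa1993_periodicCylinderLogDivCurlEstimate`
(`Ferrari1993LogEstimateReduction.lean`; Shirota–Yanagisawa 1993, proof of (15) pp. 80–81;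
Ferrari 1993, Cor. 1 (31) p. 286) says: for `L > 0` there is `C` such that every velocity field
`v` smooth on the closed cylinder `{r ≤ 1}`, `L`-periodic in `z`, divergence free in `{r < 1}`
and tangential on `{r = 1}` satisfies `‖Dv(x)‖ ≤ C (e + 1 + (1 + log⁺ n) A)` on `{r < 1}` for
all upper bounds `n ≥ ‖v‖_{H³(cell)}`, `e ≥ ‖v‖_{L²(cell)}`, `A ≥ sup_{r<1} |curl v|`. Both
printed proofs first establish, for an auxiliary radius, a **`δ`-family** of bounds — Ferrari's
global estimate (71) p. 292, `|D_k v|_{L^∞(Ω)} ≤ (C₁ − C₂ log δ)|φ|_{L^∞(Ω)} + C δ^{1/2} ‖φ‖_{H²(Ω)}`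
(`φ = curl v`, `δ ≤ ε(Ω)`, from the interior and boundary estimates (50) p. 289, (70) p. 292);
Shirota–Yanagisawa (21) p. 81 at scale `ρ` — and then choose the radius in terms of the
Sobolev norm ((72) p. 293: `δ = min{(|φ|_{L^∞}/‖φ‖_{H²})², ε}`; (21): `ρ = ρ₀ ‖u‖_s^{-4}` when
`‖u‖_s > 1`). In the rendering of this chain the `δ`-family reads: for `L > 0` there is `C` such
that every admissible `v` satisfies `‖Dv(x)‖ ≤ C (e + (1 + log(1/δ)) A + δ^{1/2} n)` on
`{r < 1}` for all `0 < δ ≤ 1` and all upper bounds `n, e, A` as above.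

This file proves that the two statements are **equivalent**, with explicit constants:

* `ShirotaYanagisawa1993_periodicCylinderLogDivCurlEstimate_of_deltaFamily`: the `δ`-family with
  constant `C` gives the estimate with constant `2C` — the printed choice of the radius, here
  `δ = max(1, n)^{-2}`, for which `log(1/δ) = 2 log⁺ n` and `δ^{1/2} n ≤ 1`;
* `periodicCylinderDeltaLogDivCurlEstimate_of_logDivCurlEstimate`: the estimate with constant
  `C` gives the `δ`-family with the *same* constant `C` — by **scaling**. The admissible class
  is a cone (smoothness, periodicity, `div v = 0` and `v·e_r = 0` are linear conditions) and the
  four sizes `‖Dv(x)‖`, `‖v‖_{H³(cell)}`, `‖v‖_{L²(cell)}`, `sup |curl v|` are positively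
  homogeneous of degree one (`fderiv_const_smul`, `eSobolevDomainNorm_const_smul_le`,
  `eLpNorm_const_smul`, `curl_const_smul`), so the estimate applied to `c v`, `c > 0`, and
  divided by `c` reads `‖Dv(x)‖ ≤ C (e + c⁻¹ + (1 + log⁺(c n)) A)`
  (`norm_fderiv_le_of_logDivCurlBound_smul`); for `n > 0` the choice `c = (δ^{1/2} n)⁻¹` gives
  `c⁻¹ = δ^{1/2} n` and `log⁺(c n) = log⁺(δ^{-1/2}) = ½ log(1/δ)` (`δ ≤ 1`), and for `n = 0` one
  lets `c → ∞`;
* `ShirotaYanagisawa1993_periodicCylinderLogDivCurlEstimate_iff_deltaFamily`: the equivalence.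

## Review record (D-0026): the named fact `ShirotaYanagisawa1993_periodicCylinderDeltaLogDivCurlEstimate` is merged back

The `δ`-family first landed in this file as the named fact
`ShirotaYanagisawa1993_periodicCylinderDeltaLogDivCurlEstimate`, minted by the prove seat of
`ShirotaYanagisawa1993_periodicCylinderLogDivCurlEstimate` as its decomposition child, together
with the proved choice of `δ` (`…_of_deltaFamily`). The child's own prove seat triaged it XL and
asked for a further split; decompositions do not recurse. The split review, with
Ferrari pp. 286–293 and Shirota–Yanagisawa pp. 80–81 open, found:

* the statement is **faithful** to the printed intermediate (71) (rendering and adaptation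
  caveat below, those of the accepted docstring) and is **neither open nor misstated**;
* it is **not provable inline**: like its parent it is the potential theory of the div–curl
  system up to the curved wall (Solonnikov's Green matrix, Ferrari's Thm 4 p. 285, with the
  Agmon–Douglis–Nirenberg `W^{1,p}` estimate, Thm 3 p. 285; Shirota–Yanagisawa (9)–(10),
  (18)–(23) import the same two theories), absent from Mathlib and from the tree
  (`PeriodicCylinderGreenMatrix.lean` records the hypothesis-form predicate
  `IsPeriodicCylinderGreenMatrix` and the derivation plan of (71) from it);
* as a decomposition child it is **mis-cut**: by the scaling argument above it is *equivalent*
  to its parent, with the same constant — the parent reworded, not a distinct published result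
  of smaller size —, so the split discharged nothing (the step it peeled off, the choice of
  `δ`, is forty lines); its only consumers were the glue `…_of_deltaFamily` here and
  `ShirotaYanagisawa1993_periodicCylinderDeltaLogDivCurlEstimate_of_vorticityH2DeltaFamily`
  (`Ferrari1993Prop1DeltaFamily.lean`: the family from Ferrari's (71),
  `Ferrari1993_periodicCylinderVorticityH2DeltaLogEstimate`, by `‖curl v‖_{H²} ≤ C_S ‖v‖_{H³}`).

It was therefore **merged back** into the proof obligation of its parent: the `def` is deleted;
its body, unchanged, is the written-out hypothesis `hB` of
`ShirotaYanagisawa1993_periodicCylinderLogDivCurlEstimate_of_deltaFamily` here (name and proof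
unchanged) and the written-out conclusion of
`ShirotaYanagisawa1993_periodicCylinderDeltaLogDivCurlEstimate_of_vorticityH2DeltaFamily` there
(name and proof unchanged; that file no longer imports this one), so that the composition
`ShirotaYanagisawa1993_periodicCylinderLogDivCurlEstimate_of_deltaFamily ∘
ShirotaYanagisawa1993_periodicCylinderDeltaLogDivCurlEstimate_of_vorticityH2DeltaFamily : (71) → (31)`
type-checks as before; the converse direction is added, proved. Nothing is weakened, no
statement of the chain `(71) → ShirotaYanagisawa1993_periodicCylinderLogDivCurlEstimate →
ShirotaYanagisawa1993_periodicCylinderLogEstimate → Ferrari1993_periodicCylinderH3Bound →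
Ferrari1993_periodicCylinderContinuation → Ferrari1993_periodicCylinderEulerBKM` changes, and its
trust base is unchanged: Ferrari's (71), `Ferrari1993_periodicCylinderVorticityH2DeltaLogEstimate`
(`Ferrari1993Prop1DeltaFamily.lean`, `Ferrari1993ContinuationLeaves.lean`).

## Faithfulness of the written-out `δ`-family / what is NOT here

* The `δ`-family (hypothesis `hB`, conclusion of the converse) keeps every hypothesis of
  `ShirotaYanagisawa1993_periodicCylinderLogDivCurlEstimate` (fields `C^∞` on the closed cylinder,
  `L`-periodic, divergence free in `{r < 1}`, tangential on `{r = 1}`; the sizes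
  `‖v‖_{H³(cell)}` — the tree's `eSobolevDomainNorm 3 2 (cylinderCell L) volume` —,
  `‖v‖_{L²(cell)}`, `sup_{r<1} |curl v|` enter as upper bounds `n, e, A`, the right-hand side
  being monotone in them) and adds the radius `0 < δ ≤ 1`. Against the print: Ferrari's
  near-field term is `δ^{1/2} ‖curl v‖_{H²(Ω)}`, which `δ^{1/2} ‖v‖_{H³}` dominates
  (`‖curl v‖_{H²} ≤ C_S ‖v‖_{H³}`, `exists_eSobolevDomainNorm_curl_le`); Ferrari restricts to
  `δ ≤ ε(Ω)`, the bound at radius `ε` dominating the one at `ε < δ ≤ 1` up to a constant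
  absorbed in `C`; `(C₁ − C₂ log δ)` is written `C (1 + log(1/δ))`; Ferrari's `Ω` is simply
  connected (no harmonic fields), while Shirota–Yanagisawa bound the harmonic components by
  `‖u‖₀` ((17) p. 80), whence the `L²` term. Adaptation caveat of the whole chain: the printed
  estimates concern bounded smooth domains of `ℝ³`; the periodic cylinder `{r ≤ 1} × ℝ/Lℤ` is a
  compact flat manifold with boundary whose harmonic fields (the multiples of `e_z`) have zero
  gradient.
* Not here: any named fact; the discharge of the parent (see the review record).

Tree search: `lean search 'DeltaLogDivCurl'` — this file, `Ferrari1993Prop1DeltaFamily.lean`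
(Ferrari's (71) and the family derived from it) and docstring mentions only; no homogeneity
lemma for the tree's Sobolev norm beyond order one (`eSobolevDomainNorm_one_const_smul_le`,
`SobolevTraceOperator.lean`), whence `eSobolevDomainNorm_const_smul_le` below (all orders, by
induction on the order, from `HasWeakFDerivOn.const_smul`, `SobolevDomainNormProofs.lean`).
Mathlib: `eLpNorm_const_smul`, `fderiv_const_smul`, `Real.posLog_eq_log`, `Real.log_rpow`.
-/

noncomputable section

open MeasureTheory Set Function Filter Topology TopologicalSpace
open scoped ContDiff NNReal ENNReal InnerProductSpace RealInnerProductSpace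

namespace Literature.Analysis.FluidPDE

open Literature.Analysis.FunctionSpaces

/-! ### Homogeneity of the Sobolev norm -/

section SobolevHomogeneity

variable {E' : Type*} [NormedAddCommGroup E'] [NormedSpace ℝ E'] [MeasurableSpace E']
  [FiniteDimensional ℝ E'] {F : Type*} [NormedAddCommGroup F] [NormedSpace ℝ F]
  {p : ℝ≥0∞} {Ω : Opens E'} {μ : Measure E'}

/-- `‖c • f‖_{W^{k,p}(Ω)} ≤ ‖c‖ ‖f‖_{W^{k,p}(Ω)}` for `c ≠ 0`, by induction on `k`
(`HasWeakFDerivOn.const_smul`, `ENNReal.mul_iInf_of_ne`). [folklore] -/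
private theorem eSobolevDomainNorm_const_smul_le_aux {c : ℝ} (hc : c ≠ 0) :
    ∀ (k : ℕ) (f : E' → F),
      eSobolevDomainNorm k p Ω μ (c • f) ≤ ‖c‖ₑ * eSobolevDomainNorm k p Ω μ f
  | 0, f => by
    rw [eSobolevDomainNorm_zero, eSobolevDomainNorm_zero, eLpNorm_const_smul]
  | k + 1, f => by
    have hc0 : ‖c‖ₑ ≠ 0 := by simpa using hc
    have hct : ‖c‖ₑ ≠ ⊤ := enorm_ne_top
    rw [eSobolevDomainNorm, eSobolevDomainNorm, mul_add, ← eLpNorm_const_smul]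
    refine add_le_add le_rfl ?_
    rw [ENNReal.mul_iInf_of_ne hc0 hct]
    refine le_iInf fun g => ?_
    rw [ENNReal.mul_iInf_of_ne hc0 hct]
    refine le_iInf fun hg => ?_
    refine (iInf₂_le (c • g) (hg.const_smul c)).trans ?_
    rw [Finset.mul_sum]
    exact Finset.sum_le_sum fun i _ =>
      eSobolevDomainNorm_const_smul_le_aux hc k (fun x => g x (Module.finBasis ℝ E' i))

/-- **Homogeneity of the Sobolev norm**: `‖c • f‖_{W^{k,p}(Ω)} ≤ ‖c‖ ‖f‖_{W^{k,p}(Ω)}` for every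
order `k`, exponent `p`, open set `Ω`, measure `μ` and real scalar `c` (Brezis, *Functional
Analysis*, §9.1: `W^{k,p}(Ω)` is a normed space; in the tree's sum-infimum form of the norm,
`c • g` is a weak derivative of `c • f` whenever `g` is one of `f`, `HasWeakFDerivOn.const_smul`,
and `‖0‖_{W^{k,p}} = 0`, `SobolevApprox.eSobolevDomainNorm_zero_fun`; the order-one case is
`eSobolevDomainNorm_one_const_smul_le`). Equality holds for `c ≠ 0` (apply the inequality to
`c⁻¹` and `c • f`); only the inequality is recorded. [folklore] -/
theorem eSobolevDomainNorm_const_smul_le (c : ℝ) (k : ℕ) (f : E' → F) :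
    eSobolevDomainNorm k p Ω μ (c • f) ≤ ‖c‖ₑ * eSobolevDomainNorm k p Ω μ f := by
  rcases eq_or_ne c 0 with rfl | hc
  · rw [zero_smul, SobolevApprox.eSobolevDomainNorm_zero_fun]
    exact zero_le
  · exact eSobolevDomainNorm_const_smul_le_aux hc k f

end SobolevHomogeneity

/-- Local notation for physical space `ℝ³ = EuclideanSpace ℝ (Fin 3)`. -/
local notation "ℝ³" => EuclideanSpace ℝ (Fin 3)

/-! ### Scaling: the estimate for `c • v` -/

/-- **Scaling step.** If the stationary logarithmic bound holds at period `L` with constant `C`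
— `‖Dw(x)‖ ≤ C (e + 1 + (1 + log⁺ n) A)` on `{r < 1}` for every admissible `w` and all upper
bounds `n ≥ ‖w‖_{H³(cell)}`, `e ≥ ‖w‖_{L²(cell)}`, `A ≥ sup_{r<1} |curl w|` (the body of
`ShirotaYanagisawa1993_periodicCylinderLogDivCurlEstimate` at `L`, `C`) —, then for every
admissible `v` with sizes bounded by `n, e, A` and every `c > 0`,
`‖Dv(x)‖ ≤ C (e + c⁻¹ + (1 + log⁺(c n)) A)` on `{r < 1}`: apply the bound to `w = c • v`,
which is admissible (the class is a cone) with `‖w‖_{H³(cell)} ≤ c n`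
(`eSobolevDomainNorm_const_smul_le`), `‖w‖_{L²(cell)} ≤ c e` (`eLpNorm_const_smul`),
`|curl w| ≤ c A` (`curl_const_smul`), and divide `‖Dw(x)‖ = c ‖Dv(x)‖` (`fderiv_const_smul`)
by `c`. [folklore] -/
theorem norm_fderiv_le_of_logDivCurlBound_smul {L : ℝ} {C : ℝ≥0}
    (hC : ∀ (w : ℝ³ → ℝ³) (_hw : ContDiffOn ℝ ∞ w (closure (unitCylinder : Set ℝ³)))
      (_hper : IsAxiallyPeriodic L w)
      (_hdiv : ∀ x ∈ (unitCylinder : Set ℝ³), VectorCalculus.divergence w x = 0)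
      (_hslip : ∀ x ∈ frontier (unitCylinder : Set ℝ³), ⟪w x, eR x⟫ = 0) (n e A : ℝ≥0)
      (_hn : eSobolevDomainNorm 3 2 (cylinderCell L) volume w ≤ n)
      (_he : eLpNorm w 2 (volume.restrict (cylinderCell L : Set ℝ³)) ≤ e)
      (_hA : ∀ x ∈ (unitCylinder : Set ℝ³), ‖curl w x‖ ≤ A),
      ∀ x ∈ (unitCylinder : Set ℝ³), ‖fderiv ℝ w x‖ ≤ C * (e + 1 + (1 + Real.posLog n) * A))
    {v : ℝ³ → ℝ³} (hv : ContDiffOn ℝ ∞ v (closure (unitCylinder : Set ℝ³)))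
    (hper : IsAxiallyPeriodic L v)
    (hdiv : ∀ x ∈ (unitCylinder : Set ℝ³), VectorCalculus.divergence v x = 0)
    (hslip : ∀ x ∈ frontier (unitCylinder : Set ℝ³), ⟪v x, eR x⟫ = 0) {n e A : ℝ≥0}
    (hn : eSobolevDomainNorm 3 2 (cylinderCell L) volume v ≤ n)
    (he : eLpNorm v 2 (volume.restrict (cylinderCell L : Set ℝ³)) ≤ e)
    (hA : ∀ x ∈ (unitCylinder : Set ℝ³), ‖curl v x‖ ≤ A) {x : ℝ³}
    (hx : x ∈ (unitCylinder : Set ℝ³)) {c : ℝ} (hc : 0 < c) :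
    ‖fderiv ℝ v x‖ ≤ C * (e + c⁻¹ + (1 + Real.posLog (c * n)) * A) := by
  -- differentiability of `v` in the open cylinder
  have hvd : ∀ y ∈ (unitCylinder : Set ℝ³), DifferentiableAt ℝ v y := fun y hy =>
    (hv.differentiableOn (by simp) y (subset_closure hy)).differentiableAt
      (closure_unitCylinder_mem_nhds hy)
  -- the rescaled field is admissible
  set w : ℝ³ → ℝ³ := fun y => c • v y with hw
  have hwv : ContDiffOn ℝ ∞ w (closure (unitCylinder : Set ℝ³)) := hv.const_smul c
  have hwper : IsAxiallyPeriodic L w := fun y => by simp only [hw, hper y]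
  have hwD : ∀ y ∈ (unitCylinder : Set ℝ³), fderiv ℝ w y = c • fderiv ℝ v y :=
    fun y hy => fderiv_const_smul (hvd y hy) c
  have hwdiv : ∀ y ∈ (unitCylinder : Set ℝ³), VectorCalculus.divergence w y = 0 := by
    intro y hy
    unfold VectorCalculus.divergence
    rw [hwD y hy, ContinuousLinearMap.toLinearMap_smul, map_smul, smul_eq_mul]
    exact mul_eq_zero_of_right _ (hdiv y hy)
  have hwslip : ∀ y ∈ frontier (unitCylinder : Set ℝ³), ⟪w y, eR y⟫ = 0 := fun y hy => by
    simp only [hw, real_inner_smul_left, hslip y hy, mul_zero]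
  -- its sizes, with `c' = c` as a nonnegative real
  set c' : ℝ≥0 := ⟨c, hc.le⟩ with hc'
  have hcc : ((c' : ℝ≥0) : ℝ) = c := rfl
  have hcen : ‖c‖ₑ = (c' : ℝ≥0∞) := by
    rw [Real.enorm_eq_ofReal hc.le, ← hcc, ENNReal.ofReal_coe_nnreal]
  have hwn : eSobolevDomainNorm 3 2 (cylinderCell L) volume w ≤ (c' * n : ℝ≥0) := by
    calc eSobolevDomainNorm 3 2 (cylinderCell L) volume w
        ≤ ‖c‖ₑ * eSobolevDomainNorm 3 2 (cylinderCell L) volume v :=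
          eSobolevDomainNorm_const_smul_le c 3 v
      _ ≤ (c' : ℝ≥0∞) * n := by rw [hcen]; gcongr
      _ = ((c' * n : ℝ≥0) : ℝ≥0∞) := (ENNReal.coe_mul c' n).symm
  have hwe : eLpNorm w 2 (volume.restrict (cylinderCell L : Set ℝ³)) ≤ (c' * e : ℝ≥0) := by
    calc eLpNorm w 2 (volume.restrict (cylinderCell L : Set ℝ³))
        = ‖c‖ₑ * eLpNorm v 2 (volume.restrict (cylinderCell L : Set ℝ³)) :=
          eLpNorm_const_smul c v _ _
      _ ≤ (c' : ℝ≥0∞) * e := by rw [hcen]; gcongr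
      _ = ((c' * e : ℝ≥0) : ℝ≥0∞) := (ENNReal.coe_mul c' e).symm
  have hwA : ∀ y ∈ (unitCylinder : Set ℝ³), ‖curl w y‖ ≤ (c' * A : ℝ≥0) := by
    intro y hy
    rw [hw, curl_const_smul (hvd y hy), norm_smul, Real.norm_of_nonneg hc.le, NNReal.coe_mul,
      hcc]
    exact mul_le_mul_of_nonneg_left (hA y hy) hc.le
  -- the bound for `w` at `x`, divided by `c`
  have key := hC w hwv hwper hwdiv hwslip (c' * n) (c' * e) (c' * A) hwn hwe hwA x hx
  rw [hwD x hx, norm_smul, Real.norm_of_nonneg hc.le] at key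
  push_cast at key
  rw [hcc] at key
  refine le_of_mul_le_mul_left (key.trans_eq ?_) hc
  field_simp

/-! ### The estimate implies its `δ`-family -/

/-- **The stationary logarithmic div–curl estimate implies its `δ`-family, with the same
constant.** From `ShirotaYanagisawa1993_periodicCylinderLogDivCurlEstimate` (Shirota–Yanagisawa
1993, (15) p. 80 in stationary form; Ferrari 1993, Cor. 1 (31) p. 286): for `L > 0` there is
`C` such that every `v` smooth on the closed cylinder, `L`-periodic, divergence free in `{r < 1}`
and tangential on `{r = 1}` satisfies, for all `0 < δ ≤ 1` and all upper bounds
`n ≥ ‖v‖_{H³(cell)}`, `e ≥ ‖v‖_{L²(cell)}`, `A ≥ sup_{r<1} |curl v|`,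
`‖Dv(x)‖ ≤ C (e + (1 + log(1/δ)) A + δ^{1/2} n)` on `{r < 1}` — the rendering of Ferrari's (71)
p. 292 in this chain, i.e. the body, unchanged and written out, of the former named fact
`ShirotaYanagisawa1993_periodicCylinderDeltaLogDivCurlEstimate` (merged back, module docstring).
Proof by scaling (`norm_fderiv_le_of_logDivCurlBound_smul`): for `n > 0` take
`c = (δ^{1/2} n)⁻¹`, so that `c⁻¹ = δ^{1/2} n` and `log⁺(c n) = log⁺(δ^{-1/2}) = ½ log(1/δ)`;
for `n = 0`, `‖Dv(x)‖ ≤ C (e + c⁻¹ + A)` for every `c > 0`, hence `≤ C (e + A)`. [folklore] -/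
theorem periodicCylinderDeltaLogDivCurlEstimate_of_logDivCurlEstimate
    (h : ShirotaYanagisawa1993_periodicCylinderLogDivCurlEstimate) :
    ∀ (L : ℝ) (_hL : 0 < L), ∃ C : ℝ≥0, ∀ (v : ℝ³ → ℝ³)
      (_hv : ContDiffOn ℝ ∞ v (closure (unitCylinder : Set ℝ³)))
      (_hper : IsAxiallyPeriodic L v)
      (_hdiv : ∀ x ∈ (unitCylinder : Set ℝ³), VectorCalculus.divergence v x = 0)
      (_hslip : ∀ x ∈ frontier (unitCylinder : Set ℝ³), ⟪v x, eR x⟫ = 0) (n e A : ℝ≥0) (δ : ℝ)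
      (_hδ : 0 < δ) (_hδ₁ : δ ≤ 1)
      (_hn : eSobolevDomainNorm 3 2 (cylinderCell L) volume v ≤ n)
      (_he : eLpNorm v 2 (volume.restrict (cylinderCell L : Set ℝ³)) ≤ e)
      (_hA : ∀ x ∈ (unitCylinder : Set ℝ³), ‖curl v x‖ ≤ A),
      ∀ x ∈ (unitCylinder : Set ℝ³),
        ‖fderiv ℝ v x‖ ≤ C * (e + (1 + Real.log (1 / δ)) * A + δ ^ (1 / 2 : ℝ) * n) := by
  intro L hL
  obtain ⟨C, hC⟩ := h L hL
  refine ⟨C, ?_⟩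
  intro v hv hper hdiv hslip n e A δ hδ hδ₁ hn he hA x hx
  have hA0 : (0 : ℝ) ≤ A := A.coe_nonneg
  have hn0 : (0 : ℝ) ≤ n := n.coe_nonneg
  have hC0 : (0 : ℝ) ≤ C := C.coe_nonneg
  have hlog : 0 ≤ Real.log (1 / δ) := Real.log_nonneg ((one_le_div hδ).2 hδ₁)
  have hrp : 0 < δ ^ (1 / 2 : ℝ) := Real.rpow_pos_of_pos hδ _
  rcases eq_or_ne n 0 with rfl | hn'
  · -- `n = 0`: let the scaling parameter tend to infinity
    have hlim : ‖fderiv ℝ v x‖ ≤ C * (e + A) := by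
      refine le_of_forall_pos_le_add fun ε hε => ?_
      have hcpos : (0 : ℝ) < (C + 1) / ε := by positivity
      have key := norm_fderiv_le_of_logDivCurlBound_smul hC hv hper hdiv hslip hn he hA hx hcpos
      rw [NNReal.coe_zero, mul_zero, Real.posLog_zero, add_zero, one_mul, inv_div] at key
      refine key.trans ?_
      have : (C : ℝ) * (ε / (C + 1)) ≤ ε := by
        rw [mul_div_assoc']
        exact div_le_of_le_mul₀ (by positivity) hε.le (by nlinarith)
      nlinarith
    refine hlim.trans (mul_le_mul_of_nonneg_left ?_ hC0)
    rw [NNReal.coe_zero, mul_zero, add_zero]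
    nlinarith [mul_nonneg hlog hA0]
  · -- `n > 0`: scaling parameter `c = (δ^{1/2} n)⁻¹`
    have hnpos : (0 : ℝ) < n := lt_of_le_of_ne hn0 (by exact_mod_cast hn'.symm)
    have hcpos : (0 : ℝ) < (δ ^ (1 / 2 : ℝ) * n)⁻¹ := by positivity
    have key := norm_fderiv_le_of_logDivCurlBound_smul hC hv hper hdiv hslip hn he hA hx hcpos
    rw [inv_inv] at key
    -- `c n = δ^{-1/2}` and `log⁺ δ^{-1/2} = ½ log (1/δ)`
    have hcn : (δ ^ (1 / 2 : ℝ) * n)⁻¹ * (n : ℝ) = (δ ^ (1 / 2 : ℝ))⁻¹ := by field_simp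
    have hplog : Real.posLog ((δ ^ (1 / 2 : ℝ))⁻¹) = (1 / 2) * Real.log (1 / δ) := by
      have h1 : 1 ≤ (δ ^ (1 / 2 : ℝ))⁻¹ := by
        rw [one_le_inv₀ hrp]
        exact Real.rpow_le_one hδ.le hδ₁ (by norm_num)
      rw [Real.posLog_eq_log (by rwa [abs_of_pos (inv_pos.2 hrp)]), Real.log_inv,
        Real.log_rpow hδ, one_div δ, Real.log_inv]
      ring
    rw [hcn, hplog] at key
    refine key.trans (mul_le_mul_of_nonneg_left ?_ hC0)
    nlinarith [mul_nonneg hlog hA0, mul_nonneg hrp.le hn0]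

/-! ### The `δ`-family implies the estimate: the choice of `δ` -/

/-- **`ShirotaYanagisawa1993_periodicCylinderLogDivCurlEstimate` from its `δ`-family**
(Ferrari 1993, (72) p. 293: "the proof of the proposition is completed by setting
`δ = min{(|φ|_∞/‖φ‖_{H²})², ε}`"; Shirota–Yanagisawa 1993, (21) p. 81: `ρ = ρ₀` if `‖u‖_s ≤ 1`,
`ρ = ρ₀ ‖u‖_s^{-4}` otherwise). The hypothesis `hB` is the `δ`-family written out — the body,
unchanged, of the former named fact `ShirotaYanagisawa1993_periodicCylinderDeltaLogDivCurlEstimate`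
(merged back, module docstring), and character for character the conclusion of
`ShirotaYanagisawa1993_periodicCylinderDeltaLogDivCurlEstimate_of_vorticityH2DeltaFamily`
(`Ferrari1993Prop1DeltaFamily.lean`), which composes with this theorem into `(71) → (31)`.
Proof: apply the family with `δ = max(1, n)^{-2} ∈ (0, 1]`, for which `log(1/δ) = 2 log⁺ n` and
`δ^{1/2} n = n / max(1, n) ≤ 1`; hence `‖Dv(x)‖ ≤ C (e + (1 + 2 log⁺ n) A + 1) ≤
2C (e + 1 + (1 + log⁺ n) A)`. [cite: ShirotaYanagisawa1993, proof of (15), (21) p. 81]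
[cite: Ferrari1993, (72) p. 293] -/
theorem ShirotaYanagisawa1993_periodicCylinderLogDivCurlEstimate_of_deltaFamily
    (hB : ∀ (L : ℝ) (_hL : 0 < L), ∃ C : ℝ≥0, ∀ (v : ℝ³ → ℝ³)
      (_hv : ContDiffOn ℝ ∞ v (closure (unitCylinder : Set ℝ³)))
      (_hper : IsAxiallyPeriodic L v)
      (_hdiv : ∀ x ∈ (unitCylinder : Set ℝ³), VectorCalculus.divergence v x = 0)
      (_hslip : ∀ x ∈ frontier (unitCylinder : Set ℝ³), ⟪v x, eR x⟫ = 0) (n e A : ℝ≥0) (δ : ℝ)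
      (_hδ : 0 < δ) (_hδ₁ : δ ≤ 1)
      (_hn : eSobolevDomainNorm 3 2 (cylinderCell L) volume v ≤ n)
      (_he : eLpNorm v 2 (volume.restrict (cylinderCell L : Set ℝ³)) ≤ e)
      (_hA : ∀ x ∈ (unitCylinder : Set ℝ³), ‖curl v x‖ ≤ A),
      ∀ x ∈ (unitCylinder : Set ℝ³),
        ‖fderiv ℝ v x‖ ≤ C * (e + (1 + Real.log (1 / δ)) * A + δ ^ (1 / 2 : ℝ) * n)) :
    ShirotaYanagisawa1993_periodicCylinderLogDivCurlEstimate := by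
  intro L hL
  obtain ⟨C, hC⟩ := hB L hL
  refine ⟨2 * C, ?_⟩
  intro v hv hper hdiv hslip n e A hn he hA x hx
  -- the choice of `δ`
  set m : ℝ := max 1 (n : ℝ) with hm
  have hm1 : 1 ≤ m := le_max_left _ _
  have hm0 : 0 < m := one_pos.trans_le hm1
  have hnm : (n : ℝ) ≤ m := le_max_right _ _
  set δ : ℝ := (m ^ 2)⁻¹ with hδ
  have hδ0 : 0 < δ := by positivity
  have hδ1 : δ ≤ 1 := inv_le_one_of_one_le₀ (by nlinarith)
  have hlog : Real.log (1 / δ) = 2 * Real.posLog (n : ℝ) := by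
    rw [Real.posLog_eq_log_max_one n.coe_nonneg, ← hm, hδ, one_div, inv_inv, Real.log_pow]
    norm_num
  have hsqrt : δ ^ (1 / 2 : ℝ) = m⁻¹ := by
    rw [hδ, ← Real.sqrt_eq_rpow, Real.sqrt_inv, Real.sqrt_sq hm0.le]
  have key := hC v hv hper hdiv hslip n e A δ hδ0 hδ1 hn he hA x hx
  rw [hlog, hsqrt] at key
  -- bookkeeping
  have hfrac : m⁻¹ * (n : ℝ) ≤ 1 := by rwa [inv_mul_le_iff₀ hm0, mul_one]
  have he0 : (0 : ℝ) ≤ e := e.coe_nonneg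
  have hA0 : (0 : ℝ) ≤ A := A.coe_nonneg
  have hp0 : 0 ≤ Real.posLog (n : ℝ) := Real.posLog_nonneg
  have hsum : (e : ℝ) + (1 + 2 * Real.posLog (n : ℝ)) * A + m⁻¹ * (n : ℝ) ≤
      2 * (e + 1 + (1 + Real.posLog (n : ℝ)) * A) := by
    nlinarith [mul_nonneg hp0 hA0]
  calc ‖fderiv ℝ v x‖
      ≤ C * ((e : ℝ) + (1 + 2 * Real.posLog (n : ℝ)) * A + m⁻¹ * (n : ℝ)) := key
    _ ≤ C * (2 * (e + 1 + (1 + Real.posLog (n : ℝ)) * A)) :=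
        mul_le_mul_of_nonneg_left hsum C.coe_nonneg
    _ = ((2 * C : ℝ≥0) : ℝ) * (e + 1 + (1 + Real.posLog (n : ℝ)) * A) := by
        push_cast; ring

/-! ### The equivalence -/

/-- **The stationary logarithmic div–curl estimate is equivalent to its `δ`-family** (the
review finding of the module docstring: the rendering of Ferrari's (71) p. 292 and the stationary
form of Shirota–Yanagisawa's (15) p. 80 / Ferrari's Cor. 1 (31) p. 286 imply each other, by the
choice of the radius one way and by scaling the other). [folklore] -/
theorem ShirotaYanagisawa1993_periodicCylinderLogDivCurlEstimate_iff_deltaFamily :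
    ShirotaYanagisawa1993_periodicCylinderLogDivCurlEstimate ↔
      ∀ (L : ℝ) (_hL : 0 < L), ∃ C : ℝ≥0, ∀ (v : ℝ³ → ℝ³)
        (_hv : ContDiffOn ℝ ∞ v (closure (unitCylinder : Set ℝ³)))
        (_hper : IsAxiallyPeriodic L v)
        (_hdiv : ∀ x ∈ (unitCylinder : Set ℝ³), VectorCalculus.divergence v x = 0)
        (_hslip : ∀ x ∈ frontier (unitCylinder : Set ℝ³), ⟪v x, eR x⟫ = 0) (n e A : ℝ≥0)
        (δ : ℝ) (_hδ : 0 < δ) (_hδ₁ : δ ≤ 1)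
        (_hn : eSobolevDomainNorm 3 2 (cylinderCell L) volume v ≤ n)
        (_he : eLpNorm v 2 (volume.restrict (cylinderCell L : Set ℝ³)) ≤ e)
        (_hA : ∀ x ∈ (unitCylinder : Set ℝ³), ‖curl v x‖ ≤ A),
        ∀ x ∈ (unitCylinder : Set ℝ³),
          ‖fderiv ℝ v x‖ ≤ C * (e + (1 + Real.log (1 / δ)) * A + δ ^ (1 / 2 : ℝ) * n) :=
  ⟨periodicCylinderDeltaLogDivCurlEstimate_of_logDivCurlEstimate,
    ShirotaYanagisawa1993_periodicCylinderLogDivCurlEstimate_of_deltaFamily⟩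

end Literature.Analysis.FluidPDE
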